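/- EXTRA WIDTH seat `ym-line-cbag-p1-w4` (prover-ym-line-cbag-p1-w4-g11-0), LINE 7 `GlueballBandRecursion`, item ⟨stmt-QuantumFields-22957⟩
`OneParticleBlochSymbolFamily`: the DEGENERATE CORNER of the registered stub `stub_isolatedBandFrame : Band.IsolatedBandFrame` — at `β = 0`
(and for a trivial gauge group at every `β`) the Wilson time-slice kernel is identically `1`, so the cold-torus trace excess vanishes and
the RANK-ONE ESCAPE branch `⨅ₖ x_{k+2}^{1/(k+2)} = 0` of `IsolatedBandFrame` holds for every volume `N` (the band branch is impossible
there: the transfer operator is the rank-one mean).  Def-free helper, `--supports stmt-QuantumFields-22957`. -/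
import Literature.MathematicalPhysics.QuantumFieldTheory.WilsonTransferKernel
import Literature.MathematicalPhysics.QuantumLattice.GaugeGroups

/-!
# Route `GlueballBandRecursion`, item `OneParticleBlochSymbolFamily` (stmt-QuantumFields-22957): the escape branch at zero coupling

For the Wilson time-slice kernel `K_β = wilsonSliceKernel ρ β` on the spatial torus `(ℤ/N)³`
(`Literature/MathematicalPhysics/QuantumFieldTheory/WilsonTransferKernel`):

* **constant kernel.** If `K_β(U, U') = c` for all slices `U, U'`, then the asymmetric-torus partition function is
  `cyclicPartition ρ β N m = c ^ m`, the principal growth rate is `transferSpectralRadius ρ β N = c` (`0 ≤ c`), the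
  trace excess is `traceExcess ρ β N m = 0` (`0 < c`), and hence `⨅ k, (traceExcess ρ β N (k+2)) ^ (1/(k+2)) = 0`
  — literally the first ("rank-one escape") disjunct of `Band.IsolatedBandFrame`
  (`…/GlueballBandRecursionIsolatedBandDefs`) at that `β`, for EVERY `N`.
* **`β = 0`.** `wilsonSliceKernel ρ 0 U U' = 1` for every compact `G` and every `ρ` (all Boltzmann factors are `e⁰`
  and the Gauss-law integral is over a probability measure); so at `β = 0` the escape branch holds:
  `cyclicPartition ρ 0 N m = 1`, `transferSpectralRadius ρ 0 N = 1`, `traceExcess ρ 0 N m = 0`.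
* **trivial group.** If `G` is a `Subsingleton`, every holonomy is `1`, `wilsonAction ρ ≡ 0`, `sliceTemporalAction ρ ≡ 0`,
  so `K_β ≡ 1` at every `β` and the same conclusions hold on the whole window.

Why this is owed by any proof of the stub: at `β = 0` (or trivial `G`) the transfer operator of `K ≡ 1` is the rank-one
projection onto constants, whose only eigenvalues are `λ₊` and `0`; the band branch of `IsolatedBandFrame` asks for
`0 < n` orthonormal eigenvectors with eigenvalues in `[q_min λ₊, λ₊)`, `q_min > 0`, which do not exist — so the escape
branch is the only one available there, and this file discharges it.

HONEST FRAMING.  Elementary bookkeeping about a degenerate case; it proves neither the stub `IsolatedBandFrame`, nor the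
item, nor the (RECORD-type, strong-coupling) rung `ColdDoublingRecursionStrongCoupling`, and a fortiori not the Yang–Mills
mass gap / the summit `YangMills`.
-/

set_option autoImplicit false

noncomputable section

open MeasureTheory Filter
open Literature.MathematicalPhysics.QuantumFieldTheory

namespace Summit.QuantumFields.YangMills.Theorems.GlueballBandRecursion.Escape

variable {N n : ℕ} [NeZero N] {G : Type*} [Group G] [TopologicalSpace G] [IsTopologicalGroup G] [CompactSpace G]
  [MeasurableSpace G] [BorelSpace G] (ρ : G →* Matrix (Fin n) (Fin n) ℂ)

/-! ## Constant slice kernel -/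

/-- A constant slice kernel `K_β ≡ c` has asymmetric-torus partition functions `Z_β(m × N³) = c ^ m` (the cyclic
integrand is the constant `c ^ m` and the slice measure is a probability measure). -/
theorem cyclicPartition_eq_pow_of_sliceKernel_const {β c : ℝ}
    (hK : ∀ U U' : GaugeConfig 3 N G, wilsonSliceKernel ρ β U U' = c) (m : ℕ) [NeZero m] :
    cyclicPartition ρ β N m = c ^ m := by
  simp only [cyclicPartition, hK, Finset.prod_const, Finset.card_univ, ZMod.card, integral_const,
    smul_eq_mul, probReal_univ, one_mul]

/-- A constant slice kernel `K_β ≡ c`, `0 ≤ c`, has principal growth rate `λ₊ = limsup_m (c^{m+1})^{1/(m+1)} = c`. -/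
theorem transferSpectralRadius_eq_of_sliceKernel_const {β c : ℝ} (hc : 0 ≤ c)
    (hK : ∀ U U' : GaugeConfig 3 N G, wilsonSliceKernel ρ β U U' = c) :
    transferSpectralRadius ρ β N = c := by
  have h : ∀ m : ℕ, (cyclicPartition ρ β N (m + 1)) ^ (((m : ℝ) + 1)⁻¹) = c := fun m => by
    rw [cyclicPartition_eq_pow_of_sliceKernel_const ρ hK]
    have := Real.pow_rpow_inv_natCast hc (Nat.succ_ne_zero m)
    push_cast at this
    exact this
  simp only [transferSpectralRadius, h, limsup_const]

/-- A constant slice kernel `K_β ≡ c`, `0 < c`, has vanishing trace excess: `Z_β(m × N³)/λ₊^m − 1 = c^m/c^m − 1 = 0`. -/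
theorem traceExcess_eq_zero_of_sliceKernel_const {β c : ℝ} (hc : 0 < c)
    (hK : ∀ U U' : GaugeConfig 3 N G, wilsonSliceKernel ρ β U U' = c) (m : ℕ) [NeZero m] :
    traceExcess ρ β N m = 0 := by
  rw [traceExcess, cyclicPartition_eq_pow_of_sliceKernel_const ρ hK,
    transferSpectralRadius_eq_of_sliceKernel_const ρ hc.le hK, div_self (pow_ne_zero _ hc.ne'), sub_self]

/-- **The rank-one escape for a constant slice kernel.**  If `K_β ≡ c > 0` then
`⨅ k, (traceExcess ρ β N (k+2))^{1/(k+2)} = 0` — the first disjunct of `Band.IsolatedBandFrame` at this `β`, for every `N`. -/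
theorem iInf_traceExcess_rpow_eq_zero_of_sliceKernel_const {β c : ℝ} (hc : 0 < c)
    (hK : ∀ U U' : GaugeConfig 3 N G, wilsonSliceKernel ρ β U U' = c) :
    (⨅ k : ℕ, traceExcess ρ β N (k + 2) ^ ((1 : ℝ) / ((k : ℝ) + 2))) = 0 := by
  have h : ∀ k : ℕ, traceExcess ρ β N (k + 2) ^ ((1 : ℝ) / ((k : ℝ) + 2)) = 0 := fun k => by
    rw [traceExcess_eq_zero_of_sliceKernel_const ρ hc hK,
      Real.zero_rpow (by positivity : (0 : ℝ) < 1 / ((k : ℝ) + 2)).ne']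
  simp only [h, ciInf_const]

/-! ## Zero coupling -/

/-- **At `β = 0` the Wilson time-slice kernel is identically `1`**: both spatial Boltzmann factors are `e⁰ = 1` and the
Gauss-law integral is `∫ 1 = 1` over the product Haar probability measure of the temporal links. -/
theorem wilsonSliceKernel_zero (U U' : GaugeConfig 3 N G) : wilsonSliceKernel ρ 0 U U' = 1 := by
  simp only [wilsonSliceKernel, zero_mul, zero_div, neg_zero, Real.exp_zero, integral_const, smul_eq_mul,
    probReal_univ, one_mul]

/-- At `β = 0`: `Z_0(m × N³) = 1`. -/
theorem cyclicPartition_zero (m : ℕ) [NeZero m] : cyclicPartition ρ 0 N m = 1 := by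
  rw [cyclicPartition_eq_pow_of_sliceKernel_const ρ (wilsonSliceKernel_zero ρ), one_pow]

/-- At `β = 0`: `λ₊(0, N) = 1`. -/
theorem transferSpectralRadius_zero : transferSpectralRadius ρ 0 N = 1 :=
  transferSpectralRadius_eq_of_sliceKernel_const ρ zero_le_one (wilsonSliceKernel_zero ρ)

/-- At `β = 0`: the trace excess of every cold torus vanishes, `X_{0,N}(m) = 0`. -/
theorem traceExcess_zero (m : ℕ) [NeZero m] : traceExcess ρ 0 N m = 0 :=
  traceExcess_eq_zero_of_sliceKernel_const ρ one_pos (wilsonSliceKernel_zero ρ) m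

/-- **The escape branch of `Band.IsolatedBandFrame` at `β = 0`**, for every volume `N`:
`⨅ k, (traceExcess ρ 0 N (k+2))^{1/(k+2)} = 0`. -/
theorem iInf_traceExcess_rpow_zero :
    (⨅ k : ℕ, traceExcess ρ 0 N (k + 2) ^ ((1 : ℝ) / ((k : ℝ) + 2))) = 0 :=
  iInf_traceExcess_rpow_eq_zero_of_sliceKernel_const ρ one_pos (wilsonSliceKernel_zero ρ)

/-! ## Trivial gauge group -/

omit [TopologicalSpace G] [IsTopologicalGroup G] [CompactSpace G] [MeasurableSpace G] [BorelSpace G] in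
/-- For a trivial (`Subsingleton`) gauge group every representation matrix is the identity. -/
theorem rep_eq_one_of_subsingleton [Subsingleton G] (g : G) : ρ g = 1 := by
  rw [Subsingleton.elim g 1, map_one]

omit [TopologicalSpace G] [IsTopologicalGroup G] [CompactSpace G] [MeasurableSpace G] [BorelSpace G] in
/-- For a trivial gauge group the Wilson action vanishes identically (every plaquette holonomy is `1`, `Re tr ρ(1) = n`). -/
theorem wilsonAction_eq_zero_of_subsingleton [Subsingleton G] {d L : ℕ} [NeZero L] (U : GaugeConfig d L G) :
    wilsonAction ρ U = 0 := by
  simp only [wilsonAction, rep_eq_one_of_subsingleton ρ, Matrix.trace_one, Fintype.card_fin,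
    Complex.natCast_re, sub_self, Finset.sum_const_zero]

omit [TopologicalSpace G] [IsTopologicalGroup G] [CompactSpace G] [MeasurableSpace G] [BorelSpace G] in
/-- For a trivial gauge group the temporal plaquette energy between consecutive slices vanishes identically. -/
theorem sliceTemporalAction_eq_zero_of_subsingleton [Subsingleton G] (U : GaugeConfig 3 N G) (g : Site 3 N → G)
    (U' : GaugeConfig 3 N G) : sliceTemporalAction ρ U g U' = 0 := by
  simp only [sliceTemporalAction, rep_eq_one_of_subsingleton ρ, Matrix.trace_one, Fintype.card_fin,
    Complex.natCast_re, sub_self, Finset.sum_const_zero]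

/-- **For a trivial gauge group the Wilson time-slice kernel is identically `1` at every `β`.** -/
theorem wilsonSliceKernel_eq_one_of_subsingleton [Subsingleton G] (β : ℝ) (U U' : GaugeConfig 3 N G) :
    wilsonSliceKernel ρ β U U' = 1 := by
  simp only [wilsonSliceKernel, wilsonAction_eq_zero_of_subsingleton ρ, sliceTemporalAction_eq_zero_of_subsingleton ρ,
    mul_zero, zero_div, neg_zero, Real.exp_zero, integral_const, smul_eq_mul, probReal_univ, one_mul]

/-- Trivial gauge group: `Z_β(m × N³) = 1` at every `β`. -/
theorem cyclicPartition_eq_one_of_subsingleton [Subsingleton G] (β : ℝ) (m : ℕ) [NeZero m] :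
    cyclicPartition ρ β N m = 1 := by
  rw [cyclicPartition_eq_pow_of_sliceKernel_const ρ (wilsonSliceKernel_eq_one_of_subsingleton ρ β), one_pow]

/-- Trivial gauge group: `λ₊(β, N) = 1` at every `β`. -/
theorem transferSpectralRadius_eq_one_of_subsingleton [Subsingleton G] (β : ℝ) : transferSpectralRadius ρ β N = 1 :=
  transferSpectralRadius_eq_of_sliceKernel_const ρ zero_le_one (wilsonSliceKernel_eq_one_of_subsingleton ρ β)

/-- Trivial gauge group: the trace excess vanishes at every `β`. -/
theorem traceExcess_eq_zero_of_subsingleton [Subsingleton G] (β : ℝ) (m : ℕ) [NeZero m] :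
    traceExcess ρ β N m = 0 :=
  traceExcess_eq_zero_of_sliceKernel_const ρ one_pos (wilsonSliceKernel_eq_one_of_subsingleton ρ β) m

/-- **The escape branch of `Band.IsolatedBandFrame` for a trivial gauge group**, at every `β` and every volume `N`. -/
theorem iInf_traceExcess_rpow_eq_zero_of_subsingleton [Subsingleton G] (β : ℝ) :
    (⨅ k : ℕ, traceExcess ρ β N (k + 2) ^ ((1 : ℝ) / ((k : ℝ) + 2))) = 0 :=
  iInf_traceExcess_rpow_eq_zero_of_sliceKernel_const ρ one_pos (wilsonSliceKernel_eq_one_of_subsingleton ρ β)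

end Summit.QuantumFields.YangMills.Theorems.GlueballBandRecursion.Escape

end
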